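import Mathlib
import Summits.NavierStokesRegularity.NavierStokesRegularity.Theorems.LevelSetModerationHighSpeedPressureWorkPairingOfPressureBound
import Summits.NavierStokesRegularity.NavierStokesRegularity.Theorems.LevelSetModerationHighSpeedPressureWorkEarlyWindow
import Literature.Analysis.FluidPDE.NormalisedPressureSupBound
import Literature.Analysis.FluidPDE.ClassicalSpeedBoundIncrements

/-!
# Route LevelSetModeration — `HighSpeedPressureWork`: the late bookkeeping and the bookkeeping above the threshold

Support file for item stmt-NavierStokesRegularity-18149 (`HighSpeedPressureWork`), line
`iso-speed-area-closure`. On a fibre `(ν, T)` carrying a class-uniform a priori speed bound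
`|u| ≤ G(E₀,B₀)` on `[0,T) × ℝ³`, the pairing bound of the crux WITHOUT the `M`-factor,
`PW ≤ √(F(E₀,B₀) V_c(T)) √(D_c(T))`, holds

* for the pressure work over every LATE time window `(tₑ ν/B₀², t)`, at every level `c > 0`
  (`levelSetModeration_latePairingBookkeeping`; `tₑ > 0` arbitrary, `F` depends on it), and
* for the full pressure work `PW_c(t)`, `t < T`, at every level above the threshold `2B₀`, i.e. on
  all windows `M ≥ 4B₀`, `c ∈ [M/2, M]` (`levelSetModeration_bookkeepingAboveThreshold`).

Mechanism (no time-regularity, no second derivatives): after the delay `tₑ ν/B₀² ≥ tₑ ν/G₀²`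
(`G₀ = max(G, |B₀|) + 1`) the solution is Lipschitz in space with constant `C G₀²/ν`
(quantitative parabolic smoothing, `exists_norm_fderiv_le_of_speed_le_delay`), so the normalised
pressure is bounded pointwise, `|p̃[u τ]| ≤ K = G₀²/3 + 8 G₀ (C G₀²/ν) + E₀/(2π)`
(`abs_normalisedPressure_le_of_bounds`, Stein's cancellation estimate for the Riesz transforms of a
`C¹ ∩ L²` density); a pointwise pressure bound on the fast set gives the pairing bound with
`F = K²` (`levelSetModeration_pairing_le_of_pressureBound`: slice integration by parts and
`𝒟¹ ≤ √V √D`). Above the threshold the early window contributes nothing: the fast set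
`{c < |u τ|}`, `c ≥ 2B₀`, is empty for `τ < c₀ν/B₀²` (`levelSetModeration_earlyWindow`).

Consequently the whole difficulty of the bounded-strength stub `stub_boundedPairingBookkeeping`
(L3) sits in the level window `[B₀, 2B₀)` during the early time window `(0, c₀ν/B₀²)`; the
companion file `…HighSpeedPressureWorkFourThreshold` draws the consequence that the crux restated
with threshold `4B₀` is EQUIVALENT to class-uniform boundedness.
-/

noncomputable section

-- single-conjunct summit: `Summit.<Summit>.<Problem>` repeats the name by the D-0017 layout
set_option linter.dupNamespace false

namespace Summit.NavierStokesRegularity.NavierStokesRegularity.Theorems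

open MeasureTheory Set Filter Topology Function
open scoped ENNReal
open Literature.Analysis.FluidPDE

/-! ### A solution with zero datum vanishes -/

/-- A Leray–Hopf solution (`ν ≥ 0`, no force) with continuous slices and zero datum vanishes on
`[0,T]`: `∫|u(t)|² ≤ ∫|u₀|² = 0` and the slice is continuous. [folklore] -/
theorem levelSetModeration_slice_eq_zero_of_datum {ν T : ℝ}
    {u : ℝ → EuclideanSpace ℝ (Fin 3) → EuclideanSpace ℝ (Fin 3)}
    {p : ℝ → EuclideanSpace ℝ (Fin 3) → ℝ}
    (hcl : IsClassicalNSSolutionOn (Ico 0 T) ν 0 u p) (hLH : IsLerayHopfOn T ν 0 (u 0) u)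
    (hν : 0 ≤ ν) (h0 : ∀ x, u 0 x = 0) {t : ℝ} (ht : t ∈ Ico 0 T) (x : EuclideanSpace ℝ (Fin 3)) :
    u t x = 0 := by
  obtain ⟨hint, hle⟩ := integral_norm_sq_le_of_lerayHopf hLH hν ⟨ht.1, ht.2.le⟩
  have hzero : ∫ y, ‖u 0 y‖ ^ 2 = 0 := by simp [h0]
  have hint0 : ∫ y, ‖u t y‖ ^ 2 = 0 :=
    le_antisymm (hle.trans hzero.le) (integral_nonneg fun y => sq_nonneg _)
  have hae : (fun y => ‖u t y‖ ^ 2) =ᵐ[volume] 0 :=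
    (integral_eq_zero_iff_of_nonneg (fun y => sq_nonneg _) hint).1 hint0
  have hcont : Continuous fun y => ‖u t y‖ ^ 2 := (hcl.contDiff_velocity ht).continuous.norm.pow 2
  have heq : (fun y => ‖u t y‖ ^ 2) = 0 := (hcont.ae_eq_iff_eq volume continuous_const).1 hae
  have := congr_fun heq x
  simp only [Pi.zero_apply, ne_eq, OfNat.ofNat_ne_zero, not_false_eq_true, pow_eq_zero_iff,
    norm_eq_zero] at this
  exact this

/-! ### The normalised pressure is bounded after the delay -/

/-- **Pointwise pressure bound after the smoothing delay.** For every `d > 0` there is `C ≥ 0` such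
that: if a classical solution on `ℝ³ × [0,T)` (`ν, T > 0`), Leray–Hopf from its datum with
`∫|u₀|² ≤ E₀`, is bounded by `G₀ > 0` on `[0,T) × ℝ³`, then for every `τ ∈ (d ν/G₀², T)` and every
`x`, `|p̃[u τ](x)| ≤ G₀²/3 + 8 G₀ (C G₀²/ν) + E₀/(2π)`: the slice is Lipschitz with constant
`C G₀²/ν` (`exists_norm_fderiv_le_of_speed_le_delay`) and Stein's bound
`abs_normalisedPressure_le_of_bounds` applies with `∫|u τ|² ≤ ∫|u₀|² ≤ E₀`. [folklore] -/
theorem levelSetModeration_exists_pressureSupBound_delay {d : ℝ} (hd : 0 < d) :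
    ∃ C : ℝ, 0 ≤ C ∧ ∀ {ν T G₀ E₀ : ℝ} {u : ℝ → EuclideanSpace ℝ (Fin 3) → EuclideanSpace ℝ (Fin 3)}
      {p : ℝ → EuclideanSpace ℝ (Fin 3) → ℝ}, 0 < ν → 0 < T → 0 < G₀ →
      IsClassicalNSSolutionOn (Ico 0 T) ν 0 u p → IsLerayHopfOn T ν 0 (u 0) u →
      (∫ x, ‖u 0 x‖ ^ 2) ≤ E₀ → (∀ t ∈ Ico 0 T, ∀ x, ‖u t x‖ ≤ G₀) →
      ∀ τ ∈ Ioo (d * ν / G₀ ^ 2) T, ∀ x,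
        |normalisedPressure (u τ) x| ≤ G₀ ^ 2 / 3 + 8 * G₀ * (C * G₀ ^ 2 / ν) + E₀ / (2 * Real.pi) := by
  obtain ⟨Cg, hCg⟩ := exists_norm_fderiv_le_of_speed_le_delay hd
  refine ⟨max Cg 0, le_max_right _ _, ?_⟩
  intro ν T G₀ E₀ u p hν hT hG₀ hcl hLH hE₀ hbd τ hτ x
  have hτ' : τ ∈ Ico 0 T := ⟨le_of_lt (lt_trans (by positivity) hτ.1), hτ.2⟩
  -- uniform `L²` bound of the slices
  set K : ℝ≥0∞ := (ENNReal.ofReal (∫ x, ‖u 0 x‖ ^ 2)) ^ (1 / 2 : ℝ) with hK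
  have hKtop : K ≠ ∞ := ENNReal.rpow_ne_top_of_nonneg (by norm_num) ENNReal.ofReal_ne_top
  have hL2 : ∀ t ∈ Icc 0 T, t < T → eLpNorm (u t) 2 volume ≤ K := by
    intro t ht _
    have h := lintegral_enorm_sq_le_of_lerayHopf hLH hν.le ht
    rw [eLpNorm_eq_lintegral_rpow_enorm_toReal (by norm_num) (by norm_num), ENNReal.toReal_ofNat, hK]
    refine ENNReal.rpow_le_rpow ?_ (by norm_num)
    refine le_trans (le_of_eq ?_) h
    exact lintegral_congr fun x => by rw [ENNReal.rpow_two]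
  -- the gradient bound at `τ` on the horizon `T'' = (τ + T)/2`
  set T'' : ℝ := (τ + T) / 2 with hT''
  have hT''pos : 0 < T'' := by rw [hT'']; linarith [hτ'.1, hτ.2]
  have hT''T : T'' < T := by rw [hT'']; linarith [hτ.2]
  have hτT'' : τ < T'' := by rw [hT'']; linarith [hτ.2]
  have hbd'' : ∀ t ∈ Icc 0 T'', ∀ y, ‖u t y‖ ≤ G₀ := fun t ht y => hbd t ⟨ht.1, ht.2.trans_lt hT''T⟩ y
  have hgrad : ∀ y, ‖fderiv ℝ (u τ) y‖ ≤ max Cg 0 * G₀ ^ 2 / ν := fun y => by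
    have h := hCg hν hG₀ hcl hT''pos hT''T hbd'' hKtop
      (fun t ht => hL2 t ⟨ht.1, ht.2.trans hT''T.le⟩ (ht.2.trans_lt hT''T)) τ ⟨hτ.1, hτT''⟩ y
    refine h.trans ?_
    exact div_le_div_of_nonneg_right (mul_le_mul_of_nonneg_right (le_max_left _ _) (sq_nonneg _)) hν.le
  -- Stein's bound for the slice
  have hv : ContDiff ℝ 1 (u τ) := (hcl.contDiff_velocity hτ').of_le (by norm_cast)
  have hEfin : (∫⁻ y, ‖u τ y‖ₑ ^ 2) < ⊤ :=
    lt_of_le_of_lt (lintegral_enorm_sq_le_of_lerayHopf hLH hν.le ⟨hτ'.1, hτ.2.le⟩)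
      ENNReal.ofReal_lt_top
  have hS := abs_normalisedPressure_le_of_bounds hv hEfin (fun y => hbd τ hτ' y) hgrad x
  have hEτ : ∫ y, ‖u τ y‖ ^ 2 ≤ E₀ :=
    (integral_norm_sq_le_of_lerayHopf hLH hν.le ⟨hτ'.1, hτ.2.le⟩).2.trans hE₀
  have hπ : (∫ y, ‖u τ y‖ ^ 2) / (2 * Real.pi) ≤ E₀ / (2 * Real.pi) :=
    div_le_div_of_nonneg_right hEτ (by positivity)
  linarith

/-! ### The late pairing bookkeeping -/

/-- **Late pairing bookkeeping** (bounded strength; replaces the pair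
`stub_lateKineticBookkeeping`/`stub_lateViscousBookkeeping` of line `iso-speed-area-closure` by a
direct bound on the late pressure work). On a fibre `(ν,T)` with a class-uniform speed bound
`|u| ≤ G(E₀,B₀)` on `[0,T) × ℝ³`, and for every `tₑ > 0`, there is `F` such that every member of
the class satisfies, for all `M ≥ 2B₀`, `c ∈ [M/2,M]`, `c > 0`, `t ∈ [0,T)` with `tₑν/B₀² ≤ t`:
`-∫_{tₑν/B₀²}^{t} ∫ (1 - c/|u|)₊ D(p̃[u τ])(u) ≤ √(F(E₀,B₀) V_c(T)) √(D_c(T))`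
(pointwise pressure bound after the delay, `levelSetModeration_exists_pressureSupBound_delay`
with `d = tₑ` and `G₀ = max(G(E₀,B₀), |B₀|) + 1`, then
`levelSetModeration_pairing_le_of_pressureBound`). [folklore] -/
theorem levelSetModeration_latePairingBookkeeping :
    ∀ (ν T : ℝ), 0 < ν → 0 < T → ∀ G : ℝ → ℝ → ℝ, (∀ (u : ℝ → EuclideanSpace ℝ (Fin 3) → EuclideanSpace ℝ (Fin 3)) (p : ℝ → EuclideanSpace ℝ (Fin 3) → ℝ), Literature.Analysis.FluidPDE.IsClassicalNSSolutionOn (Set.Ico 0 T) ν 0 u p → Literature.Analysis.FluidPDE.IsLerayHopfOn T ν 0 (u 0) u → Literature.Analysis.FluidPDE.HasRapidSpatialDecay (u 0) → ∀ (E₀ B₀ : ℝ), (∫ x, ‖u 0 x‖ ^ 2) ≤ E₀ → (∀ x, ‖u 0 x‖ ≤ B₀) → ∀ t ∈ Set.Ico 0 T, ∀ x, ‖u t x‖ ≤ G E₀ B₀) → ∀ tₑ : ℝ, 0 < tₑ → ∃ F : ℝ → ℝ → ℝ, ∀ (u : ℝ → EuclideanSpace ℝ (Fin 3) → EuclideanSpace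 ℝ (Fin 3)) (p : ℝ → EuclideanSpace ℝ (Fin 3) → ℝ), Literature.Analysis.FluidPDE.IsClassicalNSSolutionOn (Set.Ico 0 T) ν 0 u p → Literature.Analysis.FluidPDE.IsLerayHopfOn T ν 0 (u 0) u → Literature.Analysis.FluidPDE.HasRapidSpatialDecay (u 0) → ∀ (E₀ B₀ : ℝ), (∫ x, ‖u 0 x‖ ^ 2) ≤ E₀ → (∀ x, ‖u 0 x‖ ≤ B₀) → ∀ (M c t : ℝ), 2 * B₀ ≤ M → M / 2 ≤ c → c ≤ M → 0 < c → t ∈ Set.Ico 0 T → tₑ * ν / B₀ ^ 2 ≤ t → -(∫ τ in Set.Ioo (tₑ * ν / B₀ ^ 2) t, ∫ x, max (1 - c / ‖u τ x‖) 0 * (fderiv ℝ (Literature.Analysis.FluidPDE.normalisedPressure (u τ)) x (u τ x))) ≤ Real.sqrt (F E₀ B₀ * (∫⁻ τ in Set.Ioo 0 T, MeasureTheory.volume {x | c < ‖u τ x‖}).toReal) * Real.sqrt ((∫⁻ τ in Set.Ioo 0 T, ∫⁻ x, Set.indicator {x | c < ‖u τ x‖} (fun x => ENNReal.ofReal (‖fderiv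 ℝ (fun y => ‖u τ y‖) x‖ ^ 2)) x).toReal) := by
  intro ν T hν hT G hG tₑ htₑ
  obtain ⟨C, hC0, hP⟩ := levelSetModeration_exists_pressureSupBound_delay htₑ
  -- the constants: `G₀ = max(G, |B₀|) + 1`, `K = G₀²/3 + 8 G₀ (C G₀²/ν) + E₀⁺/(2π)`, `F = K²`
  refine ⟨fun E₀ B₀ => ((max (G E₀ B₀) |B₀| + 1) ^ 2 / 3 +
      8 * (max (G E₀ B₀) |B₀| + 1) * (C * (max (G E₀ B₀) |B₀| + 1) ^ 2 / ν) +
      max E₀ 0 / (2 * Real.pi)) ^ 2, ?_⟩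
  intro u p hcl hLH hdec E₀ B₀ hE₀ hbd0 M c t hM hMc hcM hc ht hte
  set G₀ : ℝ := max (G E₀ B₀) |B₀| + 1 with hG₀
  set K : ℝ := G₀ ^ 2 / 3 + 8 * G₀ * (C * G₀ ^ 2 / ν) + max E₀ 0 / (2 * Real.pi) with hKdef
  have hG₀pos : 0 < G₀ := by
    rw [hG₀]; exact lt_of_le_of_lt (le_trans (abs_nonneg _) (le_max_right _ _)) (lt_add_one _)
  have hK0 : 0 ≤ K := by rw [hKdef]; positivity
  have hbd : ∀ s ∈ Ico 0 T, ∀ x, ‖u s x‖ ≤ G₀ := fun s hs x =>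
    (hG u p hcl hLH hdec E₀ B₀ hE₀ hbd0 s hs x).trans
      (by rw [hG₀]; linarith [le_max_left (G E₀ B₀) |B₀|])
  have hE₀' : (∫ x, ‖u 0 x‖ ^ 2) ≤ max E₀ 0 := hE₀.trans (le_max_left _ _)
  show -(∫ τ in Ioo (tₑ * ν / B₀ ^ 2) t, ∫ x, max (1 - c / ‖u τ x‖) 0 *
      (fderiv ℝ (normalisedPressure (u τ)) x (u τ x))) ≤
    Real.sqrt (K ^ 2 * (∫⁻ τ in Ioo 0 T, volume {x | c < ‖u τ x‖}).toReal) *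
      Real.sqrt ((∫⁻ τ in Ioo 0 T, ∫⁻ x, {x | c < ‖u τ x‖}.indicator
        (fun x => ENNReal.ofReal (‖fderiv ℝ (fun y => ‖u τ y‖) x‖ ^ 2)) x).toReal)
  have hs0 : 0 ≤ tₑ * ν / B₀ ^ 2 := by positivity
  refine levelSetModeration_pairing_le_of_pressureBound hν hT hcl hLH hdec hc hs0 ht hK0 ?_
  intro τ hτ x hx
  -- the datum is not zero (else `u ≡ 0` and nothing is fast), so `B₀ > 0`
  have hB₀ : 0 < B₀ := by
    by_contra hB
    rw [not_lt] at hB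
    have h0 : ∀ y, u 0 y = 0 := fun y => norm_le_zero_iff.1 ((hbd0 y).trans hB)
    have hτ' : τ ∈ Ico 0 T := ⟨hs0.trans hτ.1.le, hτ.2.trans ht.2⟩
    have := levelSetModeration_slice_eq_zero_of_datum hcl hLH hν.le h0 hτ' x
    rw [this, norm_zero] at hx
    exact absurd hx (not_lt.2 hc.le)
  -- `τ` is after the delay `tₑ ν / G₀²` since `G₀ ≥ |B₀| = B₀`
  have hdelay : tₑ * ν / G₀ ^ 2 < τ := by
    refine lt_of_le_of_lt ?_ hτ.1
    have hBG : B₀ ^ 2 ≤ G₀ ^ 2 := by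
      have h1 : |B₀| ≤ G₀ := by rw [hG₀]; linarith [le_max_right (G E₀ B₀) |B₀|]
      have h2 : B₀ ≤ |B₀| := le_abs_self B₀
      nlinarith [abs_nonneg B₀]
    exact div_le_div_of_nonneg_left (by positivity) (by positivity) hBG
  exact hP hν hT hG₀pos hcl hLH hE₀' hbd τ ⟨hdelay, hτ.2.trans ht.2⟩ x

/-! ### The bookkeeping above the threshold `2B₀` -/

/-- **Bounded pairing bookkeeping above the threshold** (L3 of the crux for levels `c ≥ 2B₀`,
bounded strength, unconditional in the early window). On a fibre `(ν,T)` with a class-uniform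
speed bound `|u| ≤ G(E₀,B₀)` on `[0,T) × ℝ³` there is `F` such that every member of the class
satisfies the crux's pairing bound without the `M`-factor on all windows `M ≥ 4B₀`, `c ∈ [M/2,M]`,
`c > 0`, `t ∈ [0,T)`: `PW_c(t) ≤ √(F(E₀,B₀) V_c(T)) √(D_c(T))`. Early window: for
`τ < c₀ν/B₀²` the fast set `{c < |u τ|}` is empty (`levelSetModeration_earlyWindow`, `c ≥ 2B₀`);
afterwards the pointwise pressure bound of `levelSetModeration_exists_pressureSupBound_delay`
(`d = c₀`) holds; conclude with `levelSetModeration_pairing_le_of_pressureBound`. [folklore] -/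
theorem levelSetModeration_bookkeepingAboveThreshold :
    ∀ (ν T : ℝ), 0 < ν → 0 < T → ∀ G : ℝ → ℝ → ℝ, (∀ (u : ℝ → EuclideanSpace ℝ (Fin 3) → EuclideanSpace ℝ (Fin 3)) (p : ℝ → EuclideanSpace ℝ (Fin 3) → ℝ), Literature.Analysis.FluidPDE.IsClassicalNSSolutionOn (Set.Ico 0 T) ν 0 u p → Literature.Analysis.FluidPDE.IsLerayHopfOn T ν 0 (u 0) u → Literature.Analysis.FluidPDE.HasRapidSpatialDecay (u 0) → ∀ (E₀ B₀ : ℝ), (∫ x, ‖u 0 x‖ ^ 2) ≤ E₀ → (∀ x, ‖u 0 x‖ ≤ B₀) → ∀ t ∈ Set.Ico 0 T, ∀ x, ‖u t x‖ ≤ G E₀ B₀) → ∃ F : ℝ → ℝ → ℝ, ∀ (u : ℝ → EuclideanSpace ℝ (Fin 3) → EuclideanSpace ℝ (Fin 3)) (p : ℝ → EuclideanSpace ℝ (Fin 3) → ℝ), Literature.Analysis.FluidPDE.IsClassicalNSSolutionOn (Set.Ico 0 T) ν 0 u p → Literature.Analysis.FluidPDE.IsLerayHopfOn T ν 0 (u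 0) u → Literature.Analysis.FluidPDE.HasRapidSpatialDecay (u 0) → ∀ (E₀ B₀ : ℝ), (∫ x, ‖u 0 x‖ ^ 2) ≤ E₀ → (∀ x, ‖u 0 x‖ ≤ B₀) → ∀ (M c t : ℝ), 4 * B₀ ≤ M → M / 2 ≤ c → c ≤ M → 0 < c → t ∈ Set.Ico 0 T → -(∫ τ in Set.Ioo 0 t, ∫ x, max (1 - c / ‖u τ x‖) 0 * (fderiv ℝ (Literature.Analysis.FluidPDE.normalisedPressure (u τ)) x (u τ x))) ≤ Real.sqrt (F E₀ B₀ * (∫⁻ τ in Set.Ioo 0 T, MeasureTheory.volume {x | c < ‖u τ x‖}).toReal) * Real.sqrt ((∫⁻ τ in Set.Ioo 0 T, ∫⁻ x, Set.indicator {x | c < ‖u τ x‖} (fun x => ENNReal.ofReal (‖fderiv ℝ (fun y => ‖u τ y‖) x‖ ^ 2)) x).toReal) := by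
  intro ν T hν hT G hG
  obtain ⟨c₀, hc₀, hW⟩ := levelSetModeration_earlyWindow
  obtain ⟨C, hC0, hP⟩ := levelSetModeration_exists_pressureSupBound_delay hc₀
  refine ⟨fun E₀ B₀ => ((max (G E₀ B₀) |B₀| + 1) ^ 2 / 3 +
      8 * (max (G E₀ B₀) |B₀| + 1) * (C * (max (G E₀ B₀) |B₀| + 1) ^ 2 / ν) +
      max E₀ 0 / (2 * Real.pi)) ^ 2, ?_⟩
  intro u p hcl hLH hdec E₀ B₀ hE₀ hbd0 M c t hM hMc hcM hc ht
  set G₀ : ℝ := max (G E₀ B₀) |B₀| + 1 with hG₀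
  set K : ℝ := G₀ ^ 2 / 3 + 8 * G₀ * (C * G₀ ^ 2 / ν) + max E₀ 0 / (2 * Real.pi) with hKdef
  have hG₀pos : 0 < G₀ := by
    rw [hG₀]; exact lt_of_le_of_lt (le_trans (abs_nonneg _) (le_max_right _ _)) (lt_add_one _)
  have hK0 : 0 ≤ K := by rw [hKdef]; positivity
  have hbd : ∀ s ∈ Ico 0 T, ∀ x, ‖u s x‖ ≤ G₀ := fun s hs x =>
    (hG u p hcl hLH hdec E₀ B₀ hE₀ hbd0 s hs x).trans
      (by rw [hG₀]; linarith [le_max_left (G E₀ B₀) |B₀|])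
  have hE₀' : (∫ x, ‖u 0 x‖ ^ 2) ≤ max E₀ 0 := hE₀.trans (le_max_left _ _)
  show -(∫ τ in Ioo 0 t, ∫ x, max (1 - c / ‖u τ x‖) 0 *
      (fderiv ℝ (normalisedPressure (u τ)) x (u τ x))) ≤
    Real.sqrt (K ^ 2 * (∫⁻ τ in Ioo 0 T, volume {x | c < ‖u τ x‖}).toReal) *
      Real.sqrt ((∫⁻ τ in Ioo 0 T, ∫⁻ x, {x | c < ‖u τ x‖}.indicator
        (fun x => ENNReal.ofReal (‖fderiv ℝ (fun y => ‖u τ y‖) x‖ ^ 2)) x).toReal)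
  refine levelSetModeration_pairing_le_of_pressureBound hν hT hcl hLH hdec hc le_rfl ht hK0 ?_
  intro τ hτ x hx
  have hτ' : τ ∈ Ico 0 T := ⟨hτ.1.le, hτ.2.trans ht.2⟩
  -- the datum is not zero (else `u ≡ 0` and nothing is fast), so `B₀ > 0`
  have hB₀ : 0 < B₀ := by
    by_contra hB
    rw [not_lt] at hB
    have h0 : ∀ y, u 0 y = 0 := fun y => norm_le_zero_iff.1 ((hbd0 y).trans hB)
    have := levelSetModeration_slice_eq_zero_of_datum hcl hLH hν.le h0 hτ' x
    rw [this, norm_zero] at hx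
    exact absurd hx (not_lt.2 hc.le)
  -- `τ` is after the early window (the fast set above `2B₀` is empty before `c₀ν/B₀²`)
  have hc2 : 2 * B₀ ≤ c := by linarith
  have hlate : c₀ * ν / B₀ ^ 2 ≤ τ := by
    by_contra hlt
    rw [not_le] at hlt
    have hempty := (hW ν T u p hν hT hcl hLH hdec B₀ hB₀ hbd0 τ hτ' hlt).2 c hc2
    have hxA : x ∈ {x | c < ‖u τ x‖} := hx
    rw [hempty] at hxA
    exact hxA
  -- hence after the delay `c₀ ν / G₀²` (`G₀ > B₀`)
  have hdelay : c₀ * ν / G₀ ^ 2 < τ := by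
    refine lt_of_lt_of_le ?_ hlate
    have hBG : B₀ ^ 2 < G₀ ^ 2 := by
      have h1 : B₀ < G₀ := by
        rw [hG₀]; linarith [le_max_right (G E₀ B₀) |B₀|, le_abs_self B₀]
      nlinarith
    exact div_lt_div_of_pos_left (by positivity) (by positivity) hBG
  exact hP hν hT hG₀pos hcl hLH hE₀' hbd τ ⟨hdelay, hτ'.2⟩ x

end Summit.NavierStokesRegularity.NavierStokesRegularity.Theorems

end
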